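import Summits.CriticalPhenomena.PercolationContinuityZ3.Theorems.Transplant.KNParaChainLocN
import HarnessLib

/-!
# N1 (the `{±1}` node), LEVEL 1, (C) column: the FIXED-STRIDE LOCALISATION ROUNDS WITH TRANSVERSE DRIFT `ChainPara.LocPrmD` — the twin of
# `ChainPara.LocPrm` (C-N2) for strides whose landing pieces are read about a DRIFT `d` in the walker's own sign (`σ·Δb − d ∈ [0, Pp]` /
# `[−Pm, 0]`, exactly the piece convention of p1's `ScheduleN.route`), so that walkers of opposite signs separate transversally by `2|d|`
# per round and the transverse window grows by `e + |d|` per round: `Wk k = W + k·(e + |d|)`.  This is the device for SIGNED v-ROUNDS IN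
# THE RUN FRAME `runX` (along = the level coordinate `⌊β′/c⌋`, transverse = `α` exact with drift `d = v_α`, pieces `[v_α, n]` / `[−n, v_α]`
# read in the stride's sign: `Pp = n − v_α`, `Pm = n + v_α`), admissible over SMALL cores (a few rounds; C-STEP0.md §4 (S1)).  The along
# half-width contracts exactly as in `LocPrm` (`L := toLoc.L`, `L (k+1) = max (L k + e − sLo) sHi`); rendered as a `ScheduleN` with `d k := d`.
# Pure `ℤ` / `Site 2`.

builds on p205010 (kernel theorem, internal audit signed; external expert review pending) — nothing in this file uses p205010; nothing here is a
claim about the open node `SamePDropOfSkeletonNeg`.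
Lane `prim-bschramm`, seat `prim-bschramm-p5` (gen 9; (C) lineage; design: HOME/prim-bschramm-p5-g9/C-STEP0.md §4); helper file (`--supports stmt-CriticalPhenomena-4575`).
* §1 `LocPrmD`, `LocOKD` (`Pp + d ≤ W`, `Pm − d ≤ W`), `toLoc` (the driftless along data: `L := toLoc.L`, all `LocPrm.L_*` lemmas apply), `toLoc_ok`; §2 `Wk k = W + k(e + |d|)`,
  `InCore/InEnl/InRegion/InPrism`, `InPiece` (drift-relative); §3 **`inCore_succ_of_landing`** (signs `LocPrm.dir`, pieces `LocPrm.steerT`), `route`, `inRegion_of_inCore_succ`, `inPrism_of_inRegion`;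
  §4 **`LocPrmD.scheduleN P a c hP : ScheduleN`** (axis `a`, centre `c`; `R' := e`, `d k := d`) + rfl API, `mem_scheduleN_core_iff/_zero/_last`.
[cite: KozmaNitzan2024, §4 Lemma 12 (pp. 23–25: the rounds into the target box), Lemma 11 (pp. 22–23)] [cite: MartineauTassion2017, §4.3 Lemma 4.2 (piece choice by position; the drift v)]
-/

noncomputable section

namespace Summit.CriticalPhenomena.PercolationContinuityZ3.Theorems.Transplant

namespace ChainPara

open Literature.Probability.Percolation Literature.Probability.LatticeModels
open Literature.Probability.Percolation.KozmaNitzan.Cells (oth oth_ne eq_oth_of_ne)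
open ChainPlanar
open LocPrm (dir steerT dir_eq_or steerT_eq_or)

/-! ## §1 Parameters and admissibility -/

/-- **Parameters of a fixed-stride localisation with transverse drift**: stride progress `[sLo, sHi]`, drift `d` and landing pieces `d + [0, Pp]` /
`d + [−Pm, 0]` (transverse, read in the walker's sign), transverse half-window `W`, isotropic siting slack `e`, link box `La × Lb`, initial along
half-width `L0`, rounds `0, …, N`. [this work] -/
structure LocPrmD where
  /-- minimal along-progress of one stride -/
  sLo : ℤ
  /-- maximal along-progress of one stride -/
  sHi : ℤ
  /-- transverse drift of one stride, read in the walker's sign -/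
  d : ℤ
  /-- the `τ = 1` landing piece is `d + [0, Pp]` -/
  Pp : ℕ
  /-- the `τ = −1` landing piece is `d + [−Pm, 0]` -/
  Pm : ℕ
  /-- transverse half-window about the centre line (round `0`) -/
  W : ℕ
  /-- siting slack per round (seed centre vs contact), both directions -/
  e : ℕ
  /-- along half-size of the link box of one stride about the seed centre -/
  La : ℕ
  /-- transverse half-size of the link box -/
  Lb : ℕ
  /-- along half-width of core `0` -/
  L0 : ℕ
  /-- the rounds are `0, …, N` -/
  N : ℕ

/-- **Admissible drift-localisation parameters**: nonnegative stride progress fitting in the link box, both DRIFTED pieces inside the transverse window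
(`Pp + d ≤ W`, `Pm − d ≤ W`), siting slack at most the minimal progress. [this work] -/
structure LocOKD (P : LocPrmD) : Prop where
  /-- strides do not go backwards -/
  hs0 : 0 ≤ P.sLo
  /-- the stride interval is an interval -/
  hs : P.sLo ≤ P.sHi
  /-- one stride's landing lies in its link box (along) -/
  hsL : P.sHi ≤ P.La
  /-- the drifted upper piece fits in the window -/
  hPp : (P.Pp : ℤ) + P.d ≤ P.W
  /-- the drifted lower piece fits in the window -/
  hPm : (P.Pm : ℤ) - P.d ≤ P.W
  /-- the siting slack is at most the minimal progress -/
  he : (P.e : ℤ) ≤ P.sLo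

namespace LocPrmD

variable (P : LocPrmD)

/-- The driftless localisation with the same ALONG data (pieces `0`; only its along half-widths `L` are used). [this work] -/
def toLoc : LocPrm where
  sLo := P.sLo
  sHi := P.sHi
  Pp := 0
  Pm := 0
  W := P.W
  e := P.e
  La := P.La
  Lb := P.Lb
  L0 := P.L0
  N := P.N

variable {P} in
/-- Admissible drift parameters have admissible along data. [folklore] -/
theorem toLoc_ok (hP : LocOKD P) : LocOK P.toLoc where
  hs0 := hP.hs0
  hs := hP.hs
  hsL := hP.hsL
  hPp := Nat.zero_le _
  hPm := Nat.zero_le _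
  he := hP.he

/-! ## §2 Cores, enlarged cores, regions, the prism, pieces -/

/-- **Transverse half-width of core `k`**: `W + k·(e + |d|)` (siting slack and the two-signed drift). [this work] -/
def Wk (k : ℕ) : ℤ := P.W + (k : ℤ) * (P.e + |P.d|)

/-- **Core `k`**: `|a| ≤ L k` (the DRIFTLESS along half-width `toLoc.L k`: `L 0 = L0`, `L (k+1) = max (L k + e − sLo) sHi`), `|b| ≤ W + k·(e + |d|)`.
[cite: KozmaNitzan2024, §4 Lemma 12] -/
def InCore (k : ℕ) (a b : ℤ) : Prop := |a| ≤ P.toLoc.L k ∧ |b| ≤ P.Wk k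

/-- **Enlarged core `k`** (seed centres sited within `e` of a contact of core `k`). [this work] -/
def InEnl (k : ℕ) (a b : ℤ) : Prop := |a| ≤ P.toLoc.L k + P.e ∧ |b| ≤ P.Wk k + P.e

/-- **Region `k`** (holds the link box of every stride started from the enlarged core `k`). [cite: KozmaNitzan2024, §4 Lemma 11 (p. 22)] -/
def InRegion (k : ℕ) (a b : ℤ) : Prop := |a| ≤ P.toLoc.L k + P.e + P.La ∧ |b| ≤ P.Wk k + P.e + P.Lb

/-- **The prism** (one symmetric box holding every region `k ≤ N`). [cite: KozmaNitzan2024, §4 Lemma 11 (p. 22: Ω)] -/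
def InPrism (a b : ℤ) : Prop := |a| ≤ max (P.L0 : ℤ) P.sHi + P.e + P.La ∧ |b| ≤ P.Wk P.N + P.e + P.Lb

/-- The landing piece of sign `τ` as a predicate on the DRIFT-CORRECTED signed transverse offset `δ − d` (p1's `ScheduleN` convention). [cite: MartineauTassion2017, §3.2] -/
def InPiece (τ δ : ℤ) : Prop := (τ = 1 → 0 ≤ δ - P.d ∧ δ - P.d ≤ P.Pp) ∧ (τ = -1 → -(P.Pm : ℤ) ≤ δ - P.d ∧ δ - P.d ≤ 0)

variable {P}

/-- `0 ≤ Wk k`. [folklore] -/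
theorem Wk_nonneg (P : LocPrmD) (k : ℕ) : 0 ≤ P.Wk k := by
  unfold Wk; have := abs_nonneg P.d; nlinarith [Int.natCast_nonneg P.e, Int.natCast_nonneg k, Int.natCast_nonneg P.W]

/-- `Wk (k+1) = Wk k + e + |d|`. [folklore] -/
theorem Wk_succ (P : LocPrmD) (k : ℕ) : P.Wk (k + 1) = P.Wk k + P.e + |P.d| := by unfold Wk; push_cast; ring

/-- `W ≤ Wk k`. [folklore] -/
theorem W_le_Wk (P : LocPrmD) (k : ℕ) : (P.W : ℤ) ≤ P.Wk k := by
  unfold Wk; have := abs_nonneg P.d; nlinarith [Int.natCast_nonneg P.e, Int.natCast_nonneg k]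

/-- `Wk` is monotone. [folklore] -/
theorem Wk_mono (P : LocPrmD) {k k' : ℕ} (h : k ≤ k') : P.Wk k ≤ P.Wk k' := by
  unfold Wk
  have : (k : ℤ) ≤ k' := by exact_mod_cast h
  have := abs_nonneg P.d
  nlinarith [Int.natCast_nonneg P.e]

/-! ## §3 The route of one round -/

/-- The link box about an enlarged-core point lies in the region (public face: `route`). [cite: KozmaNitzan2024, §4 Lemma 11 (p. 22)] -/
private theorem inRegion_of_linkD {k : ℕ} {a b a' b' : ℤ} (hv : P.InEnl k a b) (ha : |a' - a| ≤ P.La) (hb : |b' - b| ≤ P.Lb) : P.InRegion k a' b' := by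
  obtain ⟨h1, h2⟩ := hv
  constructor
  · calc |a'| = |(a' - a) + a| := by ring_nf
      _ ≤ |a' - a| + |a| := abs_add_le _ _
      _ ≤ P.La + (P.toLoc.L k + P.e) := add_le_add ha h1
      _ = P.toLoc.L k + P.e + P.La := by ring
  · calc |b'| = |(b' - b) + b| := by ring_nf
      _ ≤ |b' - b| + |b| := abs_add_le _ _
      _ ≤ P.Lb + (P.Wk k + P.e) := add_le_add hb h2
      _ = P.Wk k + P.e + P.Lb := by ring

/-- **The steered landing of the centre-bound stride lies in the next core**: from an enlarged-core point `(a, b)`, with `σ = dir a` and `τ = steerT σ b`,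
every `(a', b')` with `sLo ≤ σ(a' − a) ≤ sHi` and `σ(b' − b) − d` in the piece of sign `τ` lies in core `k+1` (transverse growth `e + |d|`).
[cite: KozmaNitzan2024, §4 Lemma 12 (pp. 23–25)] [cite: MartineauTassion2017, §4.3 Lemma 4.2] -/
theorem inCore_succ_of_landing (hP : LocOKD P) {k : ℕ} {a b a' b' : ℤ} (hv : P.InEnl k a b) (h1 : P.sLo ≤ dir a * (a' - a))
    (h2 : dir a * (a' - a) ≤ P.sHi) (hpc : P.InPiece (steerT (dir a) b) (dir a * (b' - b))) : P.InCore (k + 1) a' b' := by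
  obtain ⟨ha, hb⟩ := hv
  have hPp := hP.hPp; have hPm := hP.hPm
  have hWk : (P.W : ℤ) ≤ P.Wk k := W_le_Wk P k
  have hdabs : P.d ≤ |P.d| := le_abs_self _
  have hdabs' : -P.d ≤ |P.d| := neg_le_abs _
  rw [abs_le] at ha hb
  constructor
  · -- along: `|a'| ≤ max (L k + e − sLo) sHi`
    have hLs : P.toLoc.L (k + 1) = max (P.toLoc.L k + P.e - P.sLo) P.sHi := LocPrm.L_succ P.toLoc k
    rw [hLs, abs_le]
    by_cases h0 : 0 ≤ a
    · have hd : dir a = -1 := by simp [dir, h0]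
      rw [hd] at h1 h2
      constructor
      · have := le_max_right (P.toLoc.L k + P.e - P.sLo) P.sHi; linarith
      · have := le_max_left (P.toLoc.L k + P.e - P.sLo) P.sHi; linarith
    · have hd : dir a = 1 := by simp [dir, h0]
      rw [hd] at h1 h2
      push Not at h0
      constructor
      · have := le_max_left (P.toLoc.L k + P.e - P.sLo) P.sHi; linarith
      · have := le_max_right (P.toLoc.L k + P.e - P.sLo) P.sHi; linarith
  · -- transverse: `|b'| ≤ Wk k + e + |d|`
    rw [Wk_succ, abs_le]
    obtain ⟨hp1, hm1⟩ := hpc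
    by_cases h0 : 0 ≤ a
    · have hd : dir a = -1 := by simp [dir, h0]
      rw [hd] at hp1 hm1
      by_cases hb0 : b ≤ 0
      · have ht : steerT (-1) b = -1 := by unfold steerT; rw [if_pos (by linarith)]
        have := hm1 ht
        constructor <;> nlinarith
      · have ht : steerT (-1) b = 1 := by unfold steerT; rw [if_neg (by linarith)]
        have := hp1 ht
        constructor <;> nlinarith
    · have hd : dir a = 1 := by simp [dir, h0]
      rw [hd] at hp1 hm1
      by_cases hb0 : 0 ≤ b
      · have ht : steerT 1 b = -1 := by unfold steerT; rw [if_pos (by linarith)]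
        have := hm1 ht
        constructor <;> nlinarith
      · have ht : steerT 1 b = 1 := by unfold steerT; rw [if_neg (by linarith)]
        have := hp1 ht
        constructor <;> nlinarith

/-- **THE ROUTE OF ONE DRIFT-LOCALISATION ROUND**: link boxes from the enlarged core lie in the region; steered landings lie in the next core.
[cite: KozmaNitzan2024, §4 Lemma 12 (pp. 23–25)] [cite: MartineauTassion2017, §4.3 Lemma 4.2] -/
theorem route (hP : LocOKD P) {k : ℕ} {a b : ℤ} (hv : P.InEnl k a b) :
    (∀ a' b', |a' - a| ≤ P.La → |b' - b| ≤ P.Lb → P.InRegion k a' b') ∧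
    (∀ a' b', P.sLo ≤ dir a * (a' - a) → dir a * (a' - a) ≤ P.sHi → P.InPiece (steerT (dir a) b) (dir a * (b' - b)) →
      P.InCore (k + 1) a' b') :=
  ⟨fun _ _ ha hb => inRegion_of_linkD hv ha hb, fun _ _ h1 h2 hpc => inCore_succ_of_landing hP hv h1 h2 hpc⟩

/-- **The next core lies in the region** (`sHi ≤ La`, `e ≤ sLo`, `|d| ≤ Lb`). [folklore] -/
theorem inRegion_of_inCore_succ (hP : LocOKD P) (hdL : |P.d| ≤ P.Lb) {k : ℕ} {a b : ℤ} (h : P.InCore (k + 1) a b) : P.InRegion k a b := by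
  obtain ⟨ha, hb⟩ := h
  have hsL : (P.sHi : ℤ) ≤ P.La := by exact_mod_cast hP.hsL
  constructor
  · refine ha.trans ?_
    rw [LocPrm.L_succ P.toLoc k]
    refine max_le (by have := hP.he; have := hP.hs0; simp only [toLoc] at *; linarith [Int.natCast_nonneg P.La]) ?_
    have := LocPrm.L_nonneg (toLoc_ok hP) k
    simp only [toLoc] at *
    linarith [Int.natCast_nonneg P.e]
  · rw [Wk_succ] at hb
    exact hb.trans (by linarith)

/-- **Every region `k ≤ N` lies in the prism.** [folklore] -/
theorem inPrism_of_inRegion (hP : LocOKD P) {k : ℕ} (hk : k ≤ P.N) {a b : ℤ} (h : P.InRegion k a b) : P.InPrism a b := by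
  obtain ⟨ha, hb⟩ := h
  exact ⟨ha.trans (by have := LocPrm.L_le_max (toLoc_ok hP) k; simp only [toLoc] at *; linarith), hb.trans (by linarith [Wk_mono P hk])⟩

/-! ## §4 The drift-localisation rounds as a schedule with slab targets -/

variable (P)

/-- Core `k` rendered on the plane: axis `a`, centre `c` (dBox sign `1`). [this work] -/
def pcore (a : Fin 2) (c : Site 2) (k : ℕ) : Finset (Site 2) := dBox a 1 c (-P.toLoc.L k) (P.toLoc.L k) (-P.Wk k) (P.Wk k)

/-- Region `k` rendered on the plane. [this work] -/
def pregion (a : Fin 2) (c : Site 2) (k : ℕ) : Finset (Site 2) :=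
  dBox a 1 c (-(P.toLoc.L k + P.e + P.La)) (P.toLoc.L k + P.e + P.La) (-(P.Wk k + P.e + P.Lb)) (P.Wk k + P.e + P.Lb)

/-- The prism rendered on the plane. [this work] -/
def pprism (a : Fin 2) (c : Site 2) : Finset (Site 2) :=
  dBox a 1 c (-(max (P.L0 : ℤ) P.sHi + P.e + P.La)) (max (P.L0 : ℤ) P.sHi + P.e + P.La) (-(P.Wk P.N + P.e + P.Lb)) (P.Wk P.N + P.e + P.Lb)

variable {a : Fin 2} {c : Site 2}

/-- Planar membership in a core: along offset within the driftless half-width, transverse offset within `W + k(e + |d|)`. [folklore] -/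
theorem mem_pcore_iff {k : ℕ} {y : Site 2} :
    y ∈ P.pcore a c k ↔ |y a - c a| ≤ P.toLoc.L k ∧ |y (oth a) - c (oth a)| ≤ P.W + (k : ℤ) * (P.e + |P.d|) := by
  rw [pcore, mem_dBox_iff (Or.inl rfl)]; simp only [Wk, one_mul, abs_le]

/-- Planar membership in a region: the core offsets enlarged by `e + La` along and `e + Lb` across, transverse half-width `W + k(e + |d|)`. [folklore] -/
theorem mem_pregion_iff {k : ℕ} {y : Site 2} :
    y ∈ P.pregion a c k ↔ |y a - c a| ≤ P.toLoc.L k + P.e + P.La ∧ |y (oth a) - c (oth a)| ≤ P.W + (k : ℤ) * (P.e + |P.d|) + P.e + P.Lb := by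
  rw [pregion, mem_dBox_iff (Or.inl rfl)]; simp only [Wk, one_mul, abs_le]

/-- Planar membership in the prism: along within `max L0 sHi + e + La`, across within `W + N(e + |d|) + e + Lb`. [folklore] -/
theorem mem_pprism_iff {y : Site 2} :
    y ∈ P.pprism a c ↔ |y a - c a| ≤ max (P.L0 : ℤ) P.sHi + P.e + P.La ∧ |y (oth a) - c (oth a)| ≤ P.W + (P.N : ℤ) * (P.e + |P.d|) + P.e + P.Lb := by
  rw [pprism, mem_dBox_iff (Or.inl rfl)]; simp only [Wk, one_mul, abs_le]

/-- Planar membership in the `e`-enlarged core: offsets within `L k + e` along and `W + k(e + |d|) + e` across. [folklore] -/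
theorem mem_enlarge_iff {k : ℕ} {y : Site 2} :
    y ∈ dBox a 1 c (-P.toLoc.L k - P.e) (P.toLoc.L k + P.e) (-P.Wk k - P.e) (P.Wk k + P.e) ↔
      |y a - c a| ≤ P.toLoc.L k + P.e ∧ |y (oth a) - c (oth a)| ≤ P.W + (k : ℤ) * (P.e + |P.d|) + P.e := by
  rw [mem_dBox_iff (Or.inl rfl)]; simp only [Wk, one_mul, abs_le]; constructor <;> intro h <;> obtain ⟨⟨h1, h2⟩, h3, h4⟩ := h <;>
    exact ⟨⟨by linarith, by linarith⟩, by linarith, by linarith⟩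

/-- **THE DRIFT-LOCALISATION ROUNDS AS A SCHEDULE WITH SLAB TARGETS** (axis `a`, centre `c`; `R' := e`, drift `d` at every step; the stride sign of the
route at `v` is `dir (v_a − c_a)`, the piece `steerT σ (v_{a′} − c_{a′})`). Needs `|d| ≤ Lb` (the next core inside the region). [cite: KozmaNitzan2024, §4 Lemma 12 (pp. 23–25)]
[cite: MartineauTassion2017, §4.3 Lemma 4.2] -/
def scheduleN (P : LocPrmD) (a : Fin 2) (c : Site 2) (hP : LocOKD P) (hdL : |P.d| ≤ P.Lb) : ScheduleN where
  ax := fun _ => a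
  lo := fun k => dLo a 1 c (-P.toLoc.L k) (P.toLoc.L k) (-P.Wk k) (P.Wk k)
  hi := fun k => dHi a 1 c (-P.toLoc.L k) (P.toLoc.L k) (-P.Wk k) (P.Wk k)
  region := fun k => P.pregion a c k
  prism := P.pprism a c
  N := P.N
  R' := P.e
  sLo := fun _ => P.sLo
  sHi := fun _ => P.sHi
  d := fun _ => P.d
  Pp := fun _ => P.Pp
  Pm := fun _ => P.Pm
  La := fun _ => P.La
  Lb := fun _ => P.Lb
  encl k _ := by
    rw [dBox_enlarge (Or.inl rfl)]
    intro y hy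
    have h := (P.mem_enlarge_iff).1 hy
    exact (P.mem_pregion_iff).2 ⟨h.1.trans (by linarith [Int.natCast_nonneg P.La]), h.2.trans (by linarith [Int.natCast_nonneg P.Lb])⟩
  succ k _ := by
    intro y hy
    have h := inRegion_of_inCore_succ hP hdL (k := k) (a := y a - c a) (b := y (oth a) - c (oth a)) (by
      have h' := (P.mem_pcore_iff).1 hy; exact ⟨h'.1, by unfold Wk; exact h'.2⟩)
    exact (P.mem_pregion_iff).2 ⟨h.1, by have := h.2; unfold Wk at this; exact this⟩
  sub_prism k hk := by
    intro y hy
    have h' := (P.mem_pregion_iff).1 hy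
    have h := inPrism_of_inRegion hP hk (a := y a - c a) (b := y (oth a) - c (oth a)) ⟨h'.1, by unfold Wk; exact h'.2⟩
    exact (P.mem_pprism_iff).2 ⟨h.1, by have := h.2; unfold Wk at this; exact this⟩
  nonempty k _ := dBox_nonempty (Or.inl rfl) c (by linarith [LocPrm.L_nonneg (toLoc_ok hP) k]) (by linarith [Wk_nonneg P k])
  route k _ v hv := by
    rw [dBox_enlarge (Or.inl rfl)] at hv
    have hv' : P.InEnl k (v a - c a) (v (oth a) - c (oth a)) := by
      have h := (P.mem_enlarge_iff).1 hv; exact ⟨h.1, by unfold Wk; exact h.2⟩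
    refine ⟨dir (v a - c a), dir_eq_or _, fun y hya hyb => ?_, steerT (dir (v a - c a)) (v (oth a) - c (oth a)),
      steerT_eq_or _ _, fun y h1 h2 hpc => ?_⟩
    · have h := inRegion_of_linkD hv' (a' := y a - c a) (b' := y (oth a) - c (oth a)) ?_ ?_
      · exact (P.mem_pregion_iff).2 ⟨h.1, by have := h.2; unfold Wk at this; exact this⟩
      · have : y a - c a - (v a - c a) = y a - v a := by ring
        rw [this]; exact hya
      · have : y (oth a) - c (oth a) - (v (oth a) - c (oth a)) = y (oth a) - v (oth a) := by ring
        rw [this]; exact hyb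
    · have h := inCore_succ_of_landing hP hv' (a' := y a - c a) (b' := y (oth a) - c (oth a)) ?_ ?_ ?_
      · exact (P.mem_pcore_iff).2 ⟨h.1, by have := h.2; unfold Wk at this; exact this⟩
      · have : y a - c a - (v a - c a) = y a - v a := by ring
        rw [this]; exact h1
      · have : y a - c a - (v a - c a) = y a - v a := by ring
        rw [this]; exact h2
      · have : y (oth a) - c (oth a) - (v (oth a) - c (oth a)) = y (oth a) - v (oth a) := by ring
        rw [this]
        simpa [ScheduleN.InPiece, InPiece] using hpc

section API

variable (P : LocPrmD) (a : Fin 2) (c : Site 2) (hP : LocOKD P) (hdL : |P.d| ≤ P.Lb)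

/-- The cores of the drift-localisation schedule. [folklore] -/
@[simp] theorem scheduleN_core (k : ℕ) : (P.scheduleN a c hP hdL).core k = P.pcore a c k := rfl

/-- The regions of the drift-localisation schedule. [folklore] -/
@[simp] theorem scheduleN_region (k : ℕ) : (P.scheduleN a c hP hdL).region k = P.pregion a c k := rfl

/-- The prism of the drift-localisation schedule. [folklore] -/
@[simp] theorem scheduleN_prism : (P.scheduleN a c hP hdL).prism = P.pprism a c := rfl

/-- The axis of the drift-localisation schedule. [folklore] -/
@[simp] theorem scheduleN_ax (k : ℕ) : (P.scheduleN a c hP hdL).ax k = a := rfl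

/-- The parameters of the drift-localisation schedule. [folklore] -/
theorem scheduleN_params : (P.scheduleN a c hP hdL).N = P.N ∧ (P.scheduleN a c hP hdL).R' = P.e ∧
    (∀ k, (P.scheduleN a c hP hdL).sLo k = P.sLo ∧ (P.scheduleN a c hP hdL).sHi k = P.sHi ∧ (P.scheduleN a c hP hdL).d k = P.d ∧
      (P.scheduleN a c hP hdL).Pp k = P.Pp ∧ (P.scheduleN a c hP hdL).Pm k = P.Pm ∧ (P.scheduleN a c hP hdL).La k = P.La ∧
      (P.scheduleN a c hP hdL).Lb k = P.Lb) :=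
  ⟨rfl, rfl, fun _ => ⟨rfl, rfl, rfl, rfl, rfl, rfl, rfl⟩⟩

/-- Membership in core `k`: `|y_a − c_a| ≤ L k`, `|y_{a′} − c_{a′}| ≤ W + k·(e + |d|)`. [folklore] -/
theorem mem_scheduleN_core_iff {k : ℕ} {y : Site 2} :
    y ∈ (P.scheduleN a c hP hdL).core k ↔ |y a - c a| ≤ P.toLoc.L k ∧ |y (oth a) - c (oth a)| ≤ P.W + (k : ℤ) * (P.e + |P.d|) := by
  rw [scheduleN_core, mem_pcore_iff]

/-- The start core is the start box `{|y_a − c_a| ≤ L0, |y_{a′} − c_{a′}| ≤ W}`. [folklore] -/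
theorem mem_scheduleN_core_zero {y : Site 2} : y ∈ (P.scheduleN a c hP hdL).core 0 ↔ |y a - c a| ≤ P.L0 ∧ |y (oth a) - c (oth a)| ≤ P.W := by
  rw [mem_scheduleN_core_iff]; simp [toLoc]

/-- **The last core is one stride wide** once `L0 ≤ sHi + (N+1)(sLo − e)`: `{|y_a − c_a| ≤ sHi, |y_{a′} − c_{a′}| ≤ W + (N+1)(e + |d|)}`.
[cite: KozmaNitzan2024, §4 Lemma 12 (pp. 23–25)] -/
theorem mem_scheduleN_core_last (hL : (P.L0 : ℤ) ≤ P.sHi + ((P.N : ℤ) + 1) * (P.sLo - P.e)) {y : Site 2} :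
    y ∈ (P.scheduleN a c hP hdL).core (P.N + 1) ↔ |y a - c a| ≤ P.sHi ∧ |y (oth a) - c (oth a)| ≤ P.W + ((P.N : ℤ) + 1) * (P.e + |P.d|) := by
  rw [mem_scheduleN_core_iff, LocPrm.L_eq_sHi (toLoc_ok hP) (k := P.N + 1) (by omega) (by push_cast; exact hL)]
  push_cast; rfl

end API

end LocPrmD

end ChainPara

end Summit.CriticalPhenomena.PercolationContinuityZ3.Theorems.Transplant

end
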